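import Literature.NumberTheory.Transcendental.MZVSimplexRep
import Mathlib.Analysis.SpecificLimits.Basic
import Mathlib.Analysis.SpecialFunctions.Integrals.Basic
import HarnessLib

/-!
# Slicing the ordered simplex; one-variable steps of Kontsevich's formula

Support file for `Literature.NumberTheory.Transcendental.KZ.mzvRep_value_holds`
(`MZVSimplexRepProofs.lean`), the proof of Kontsevich's iterated-integral formula
`∫_{1 > t₁ > ⋯ > t_w > 0} ∏ ω_{εᵢ}(tᵢ) dt = ζ(s)` [Kontsevich–Zagier 2001, §1.1; Zagier 1994, §9].

Everything is done with lower Lebesgue integrals (`∫⁻`, values in `ℝ≥0∞`) of the nonnegative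
integrand, so that Tonelli and monotone convergence apply unconditionally. For a binary word `ε`
(`List Bool`, read with `List.getD · · false`), a dimension `w` and an upper bound `x` write
`Λ_ε^w(x) = ∫⁻_{x > t₀ > ⋯ > t_{w-1} > 0} ∏ᵢ ω_{εᵢ}(tᵢ)`, the domain being the set
`{t : Fin w → ℝ | (∀ i, 0 < t i) ∧ (∀ i, t i < x) ∧ StrictAnti t}` (for `x = 1` this is literally
`KZ.openOrderedSimplex w`). This file proves:

* `KZ.MZVSimplex.measurableSet_simplexLT`, `KZ.MZVSimplex.cons_mem_simplexLT` — measurability and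
  the slice description `(t₀ :: t) ∈ Δ^{w+1}(x) ↔ t₀ ∈ (0, x) ∧ t ∈ Δ^w(t₀)`;
* `KZ.MZVSimplex.wordLIntegral_cons` — **slicing** (Tonelli along the first coordinate,
  `MeasurableEquiv.piFinSuccAbove`): `Λ_{e::ε}^{w+1}(x) = ∫⁻_{(0,x)} ω_e(t₀) Λ_ε^w(t₀) dt₀`, and
  `KZ.MZVSimplex.wordLIntegral_zero`: `Λ_ε^0(x) = 1`;
* the two one-variable steps, for countable families `∑ aᵢ t^{Nᵢ}` of monomials with `ℝ≥0∞`
  coefficients: `KZ.MZVSimplex.lintegral_inv_mul_tsum` (letter `0`: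
  `∫⁻_{(0,x)} t⁻¹ ∑ aᵢ t^{Nᵢ} = ∑ aᵢ x^{Nᵢ}/Nᵢ`, `Nᵢ ≥ 1`) and
  `KZ.MZVSimplex.lintegral_inv_one_sub_mul_tsum` (letter `1`, geometric expansion of `1/(1-t)`:
  `∫⁻_{(0,x)} (1-t)⁻¹ ∑ aᵢ t^{Nᵢ} = ∑_{i,m} aᵢ x^{Nᵢ+m+1}/(Nᵢ+m+1)`, `x ≤ 1`).

No definitions are introduced (the sets and integrands are written out), so that the companion
proof file stays a pure proof. Standard real analysis; [folklore] throughout, the architecture is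
that of [Zagier 1994, §9] / [Kontsevich–Zagier 2001, §1.1].
-/

noncomputable section

open MeasureTheory Set Filter ENNReal

namespace Literature.NumberTheory.Transcendental

namespace KZ

/-- `ω₁(t) = 1/(1-t)`. [folklore] -/
@[simp] theorem mzvForm_true (t : ℝ) : mzvForm true t = 1 / (1 - t) := rfl

/-- `ω₀(t) = 1/t`. [folklore] -/
@[simp] theorem mzvForm_false (t : ℝ) : mzvForm false t = 1 / t := rfl

namespace MZVSimplex

/-! ### The ordered simplex below `x` and its slices -/

/-- The ordered open simplex `{x > t₀ > ⋯ > t_{w-1} > 0}` is a Borel set. [folklore] -/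
theorem measurableSet_simplexLT (w : ℕ) (x : ℝ) :
    MeasurableSet {t : Fin w → ℝ | (∀ i, 0 < t i) ∧ (∀ i, t i < x) ∧ StrictAnti t} := by
  have h1 : MeasurableSet {t : Fin w → ℝ | ∀ i, 0 < t i} := by
    have : {t : Fin w → ℝ | ∀ i, 0 < t i} = ⋂ i, {t | 0 < t i} := by ext; simp
    rw [this]
    exact MeasurableSet.iInter fun i => measurableSet_lt measurable_const (measurable_pi_apply i)
  have h2 : MeasurableSet {t : Fin w → ℝ | ∀ i, t i < x} := by
    have : {t : Fin w → ℝ | ∀ i, t i < x} = ⋂ i, {t | t i < x} := by ext; simp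
    rw [this]
    exact MeasurableSet.iInter fun i => measurableSet_lt (measurable_pi_apply i) measurable_const
  have h3 : MeasurableSet {t : Fin w → ℝ | StrictAnti t} := by
    have : {t : Fin w → ℝ | StrictAnti t} = ⋂ i, ⋂ j, ⋂ (_ : i < j), {t | t j < t i} := by
      ext t; simp [StrictAnti]
    rw [this]
    exact MeasurableSet.iInter fun i => MeasurableSet.iInter fun j => MeasurableSet.iInter
      fun _ => measurableSet_lt (measurable_pi_apply j) (measurable_pi_apply i)
  have : {t : Fin w → ℝ | (∀ i, 0 < t i) ∧ (∀ i, t i < x) ∧ StrictAnti t} =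
      {t | ∀ i, 0 < t i} ∩ {t | ∀ i, t i < x} ∩ {t : Fin w → ℝ | StrictAnti t} := by
    ext t; simp [and_assoc]
  rw [this]
  exact (h1.inter h2).inter h3

/-- Prepending a larger element to a strictly decreasing tuple keeps it strictly decreasing.
[folklore] -/
theorem strictAnti_cons {α : Type*} [Preorder α] {k : ℕ} {a : α} {f : Fin k → α}
    (hf : StrictAnti f) (ha : ∀ i, f i < a) : StrictAnti (Fin.cons a f : Fin (k + 1) → α) := by
  intro i j hij
  induction i using Fin.cases with
  | zero =>
    induction j using Fin.cases with
    | zero => exact absurd hij (lt_irrefl _)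
    | succ j => simpa using ha j
  | succ i =>
    induction j using Fin.cases with
    | zero => exact absurd hij (Fin.not_lt_zero _)
    | succ j => simpa using hf (Fin.succ_lt_succ_iff.1 hij)

/-- **Slices of the ordered simplex.** `(t₀, t) ∈ Δ^{w+1}(x)` iff `t₀ ∈ (0, x)` and `t ∈ Δ^w(t₀)`.
[folklore] -/
theorem cons_mem_simplexLT {w : ℕ} {x t₀ : ℝ} {t : Fin w → ℝ} :
    (Fin.cons t₀ t : Fin (w + 1) → ℝ) ∈
        {t : Fin (w + 1) → ℝ | (∀ i, 0 < t i) ∧ (∀ i, t i < x) ∧ StrictAnti t} ↔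
      t₀ ∈ Ioo 0 x ∧ t ∈ {t : Fin w → ℝ | (∀ i, 0 < t i) ∧ (∀ i, t i < t₀) ∧ StrictAnti t} := by
  constructor
  · rintro ⟨hpos, hlt, hanti⟩
    refine ⟨⟨by simpa using hpos 0, by simpa using hlt 0⟩, fun i => by simpa using hpos i.succ,
      fun i => ?_, fun i j hij => ?_⟩
    · simpa using hanti (Fin.succ_pos i)
    · simpa using hanti (Fin.succ_lt_succ_iff.2 hij)
  · rintro ⟨⟨h0, hx⟩, hpos, hlt, hanti⟩
    refine ⟨fun i => ?_, fun i => ?_, strictAnti_cons hanti hlt⟩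
    · induction i using Fin.cases with
      | zero => simpa using h0
      | succ i => simpa using hpos i
    · induction i using Fin.cases with
      | zero => simpa using hx
      | succ i => simpa using (hlt i).trans hx

/-! ### The word integrand and the iterated integral `Λ_ε^w(x)` -/

/-- The word integrand `t ↦ ∏ᵢ ω_{εᵢ}(tᵢ)` (in `ℝ≥0∞`) is measurable. [folklore] -/
theorem measurable_wordIntegrand (ε : List Bool) (w : ℕ) :
    Measurable fun t : Fin w → ℝ =>
      ∏ i : Fin w, ENNReal.ofReal (mzvForm (ε.getD i false) (t i)) := by
  refine Finset.measurable_prod _ fun i _ => ENNReal.measurable_ofReal.comp ?_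
  have hm : Measurable (mzvForm (ε.getD i false)) := by
    cases ε.getD i false
    · exact measurable_const.div measurable_id
    · exact measurable_const.div (measurable_const.sub measurable_id)
  exact hm.comp (measurable_pi_apply i)

/-- Splitting off the first factor of the word integrand of `e :: ε` at `(t₀, t)`. [folklore] -/
theorem wordIntegrand_cons (e : Bool) (ε : List Bool) (w : ℕ) (t₀ : ℝ) (t : Fin w → ℝ) :
    ∏ i : Fin (w + 1), ENNReal.ofReal (mzvForm ((e :: ε).getD i false)
        ((Fin.cons t₀ t : Fin (w + 1) → ℝ) i)) =
      ENNReal.ofReal (mzvForm e t₀) *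
        ∏ i : Fin w, ENNReal.ofReal (mzvForm (ε.getD i false) (t i)) := by
  simp [Fin.prod_univ_succ]

/-- In dimension `0` the iterated integral is `1` (one point of mass `1`). [folklore] -/
theorem wordLIntegral_zero (ε : List Bool) (x : ℝ) :
    ∫⁻ t in {t : Fin 0 → ℝ | (∀ i, 0 < t i) ∧ (∀ i, t i < x) ∧ StrictAnti t},
        ∏ i : Fin 0, ENNReal.ofReal (mzvForm (ε.getD i false) (t i)) = 1 := by
  have : {t : Fin 0 → ℝ | (∀ i, 0 < t i) ∧ (∀ i, t i < x) ∧ StrictAnti t} = univ := by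
    ext t
    simp only [mem_setOf_eq, IsEmpty.forall_iff, true_and, mem_univ, iff_true]
    exact fun i => i.elim0
  rw [this, Measure.restrict_univ]
  simp [volume_pi]

/-- **Slicing** (Tonelli along the first coordinate, via `MeasurableEquiv.piFinSuccAbove`):
`Λ_{e::ε}^{w+1}(x) = ∫⁻_{t₀ ∈ (0,x)} ω_e(t₀) · Λ_ε^w(t₀)`. This is the recursion
`L_{e ε}(x) = ∫₀ˣ ω_e(t) L_ε(t) dt` of iterated integrals. [Zagier 1994, §9] [folklore] -/
theorem wordLIntegral_cons (e : Bool) (ε : List Bool) (w : ℕ) (x : ℝ) :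
    ∫⁻ t in {t : Fin (w + 1) → ℝ | (∀ i, 0 < t i) ∧ (∀ i, t i < x) ∧ StrictAnti t},
        ∏ i : Fin (w + 1), ENNReal.ofReal (mzvForm ((e :: ε).getD i false) (t i)) =
      ∫⁻ t₀ in Ioo 0 x, ENNReal.ofReal (mzvForm e t₀) *
        ∫⁻ t in {t : Fin w → ℝ | (∀ i, 0 < t i) ∧ (∀ i, t i < t₀) ∧ StrictAnti t},
          ∏ i : Fin w, ENNReal.ofReal (mzvForm (ε.getD i false) (t i)) := by
  have hφ := (volume_preserving_piFinSuccAbove (fun _ : Fin (w + 1) => ℝ) 0).symm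
  set φ := (MeasurableEquiv.piFinSuccAbove (fun _ : Fin (w + 1) => ℝ) 0).symm with hφ_def
  have hφapp : ∀ p : ℝ × (Fin w → ℝ), φ p = Fin.cons p.1 p.2 := fun p => by
    simp [hφ_def, MeasurableEquiv.piFinSuccAbove_symm_apply, Fin.insertNthEquiv,
      Fin.insertNth_zero']
  set S := {t : Fin (w + 1) → ℝ | (∀ i, 0 < t i) ∧ (∀ i, t i < x) ∧ StrictAnti t} with hS_def
  set F := fun t : Fin (w + 1) → ℝ =>
    ∏ i : Fin (w + 1), ENNReal.ofReal (mzvForm ((e :: ε).getD i false) (t i)) with hF_def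
  have hS : MeasurableSet S := measurableSet_simplexLT (w + 1) x
  have hF : Measurable F := measurable_wordIntegrand (e :: ε) (w + 1)
  rw [← lintegral_indicator hS, ← hφ.lintegral_comp_emb φ.measurableEmbedding,
    Measure.volume_eq_prod,
    lintegral_prod (fun p => S.indicator F (φ p)) ((hF.indicator hS).comp φ.measurable).aemeasurable,
    ← lintegral_indicator measurableSet_Ioo]
  refine lintegral_congr fun t₀ => ?_
  by_cases h1 : t₀ ∈ Ioo 0 x
  · rw [indicator_of_mem h1, ← lintegral_const_mul _ (measurable_wordIntegrand ε w),
      ← lintegral_indicator (measurableSet_simplexLT w t₀)]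
    refine lintegral_congr fun t => ?_
    rw [hφapp]
    by_cases h2 : t ∈ {t : Fin w → ℝ | (∀ i, 0 < t i) ∧ (∀ i, t i < t₀) ∧ StrictAnti t}
    · rw [indicator_of_mem (cons_mem_simplexLT.2 ⟨h1, h2⟩), indicator_of_mem h2, hF_def]
      exact wordIntegrand_cons e ε w t₀ t
    · rw [indicator_of_notMem h2, indicator_of_notMem]
      exact fun h => h2 (cons_mem_simplexLT.1 h).2
  · rw [indicator_of_notMem h1]
    refine (lintegral_congr fun t => ?_).trans lintegral_zero
    rw [hφapp]
    exact indicator_of_notMem (fun h => h1 (cons_mem_simplexLT.1 h).1) _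

/-! ### One-variable steps -/

/-- `t ↦ t^k` (in `ℝ≥0∞`) is measurable. [folklore] -/
theorem measurable_ofReal_pow (k : ℕ) : Measurable fun t : ℝ => ENNReal.ofReal (t ^ k) :=
  ENNReal.measurable_ofReal.comp (measurable_id.pow_const k)

/-- `∫⁻_{(0,x)} tⁿ dt = x^{n+1}/(n+1)` for `x ≥ 0`. [folklore] -/
theorem lintegral_pow_Ioo (n : ℕ) {x : ℝ} (hx : 0 ≤ x) :
    ∫⁻ t in Ioo 0 x, ENNReal.ofReal (t ^ n) = ENNReal.ofReal (x ^ (n + 1) / (n + 1)) := by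
  have hint : IntegrableOn (fun t : ℝ => t ^ n) (Ioo 0 x) :=
    (continuous_pow n).integrableOn_Icc.mono_set Ioo_subset_Icc_self
  have hnn : 0 ≤ᵐ[volume.restrict (Ioo 0 x)] fun t : ℝ => t ^ n :=
    (ae_restrict_iff' measurableSet_Ioo).2 (ae_of_all _ fun t ht => pow_nonneg ht.1.le n)
  rw [← ofReal_integral_eq_lintegral_ofReal hint hnn, ← integral_Ioc_eq_integral_Ioo,
    ← intervalIntegral.integral_of_le hx, integral_pow]
  simp

/-- The geometric series in `ℝ≥0∞`: `1/(1-t) = ∑ₘ tᵐ` for `0 ≤ t < 1`. [folklore] -/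
theorem ofReal_one_div_one_sub {t : ℝ} (ht0 : 0 ≤ t) (ht1 : t < 1) :
    ENNReal.ofReal (1 / (1 - t)) = ∑' m : ℕ, ENNReal.ofReal (t ^ m) := by
  rw [one_div, ENNReal.ofReal_inv_of_pos (sub_pos.2 ht1), ENNReal.ofReal_sub _ ht0,
    ENNReal.ofReal_one, ← ENNReal.tsum_geometric]
  exact tsum_congr fun m => (ENNReal.ofReal_pow ht0 m).symm

/-- **The letter `0`.** `∫⁻_{(0,x)} (1/t) · ∑ᵢ aᵢ t^{Nᵢ} dt = ∑ᵢ aᵢ x^{Nᵢ}/Nᵢ` (all `Nᵢ ≥ 1`;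
monotone convergence). This is `∫₀ˣ Li(t) dt/t`, raising the first exponent of a multiple
polylogarithm. [Zagier 1994, §9] [folklore] -/
theorem lintegral_inv_mul_tsum {ι : Type*} [Countable ι] (a : ι → ℝ≥0∞) (N : ι → ℕ)
    (hN : ∀ i, 1 ≤ N i) {x : ℝ} (hx : 0 ≤ x) :
    ∫⁻ t in Ioo 0 x, ENNReal.ofReal (1 / t) * ∑' i, a i * ENNReal.ofReal (t ^ N i) =
      ∑' i, a i * ENNReal.ofReal (x ^ N i / N i) := by
  calc ∫⁻ t in Ioo 0 x, ENNReal.ofReal (1 / t) * ∑' i, a i * ENNReal.ofReal (t ^ N i)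
      = ∫⁻ t in Ioo 0 x, ∑' i, a i * ENNReal.ofReal (t ^ (N i - 1)) := by
        refine setLIntegral_congr_fun measurableSet_Ioo fun t ht => ?_
        rw [← ENNReal.tsum_mul_left]
        refine tsum_congr fun i => ?_
        rw [mul_left_comm, ← ENNReal.ofReal_mul (one_div_nonneg.2 ht.1.le)]
        congr 2
        obtain ⟨m, hm⟩ := Nat.exists_eq_add_of_le' (hN i)
        rw [hm, Nat.add_sub_cancel, pow_succ]
        field_simp [ht.1.ne']
    _ = ∑' i, ∫⁻ t in Ioo 0 x, a i * ENNReal.ofReal (t ^ (N i - 1)) :=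
        lintegral_tsum fun i => ((measurable_ofReal_pow _).const_mul _).aemeasurable
    _ = ∑' i, a i * ENNReal.ofReal (x ^ N i / N i) := by
        refine tsum_congr fun i => ?_
        rw [lintegral_const_mul _ (measurable_ofReal_pow _), lintegral_pow_Ioo _ hx]
        obtain ⟨m, hm⟩ := Nat.exists_eq_add_of_le' (hN i)
        rw [hm, Nat.add_sub_cancel]
        push_cast
        ring_nf

/-- **The letter `1`.** `∫⁻_{(0,x)} 1/(1-t) · ∑ᵢ aᵢ t^{Nᵢ} dt = ∑_{(i,m)} aᵢ x^{Nᵢ+m+1}/(Nᵢ+m+1)`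
for `0 ≤ x ≤ 1` (geometric expansion of `1/(1-t)`, monotone convergence). This is
`∫₀ˣ Li(t) dt/(1-t)`, prepending an exponent `1` to a multiple polylogarithm.
[Zagier 1994, §9] [folklore] -/
theorem lintegral_inv_one_sub_mul_tsum {ι : Type*} [Countable ι] (a : ι → ℝ≥0∞) (N : ι → ℕ)
    {x : ℝ} (hx0 : 0 ≤ x) (hx1 : x ≤ 1) :
    ∫⁻ t in Ioo 0 x, ENNReal.ofReal (1 / (1 - t)) * ∑' i, a i * ENNReal.ofReal (t ^ N i) =
      ∑' p : ι × ℕ, a p.1 * ENNReal.ofReal (x ^ (N p.1 + p.2 + 1) / (N p.1 + p.2 + 1 : ℕ)) := by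
  calc ∫⁻ t in Ioo 0 x, ENNReal.ofReal (1 / (1 - t)) * ∑' i, a i * ENNReal.ofReal (t ^ N i)
      = ∫⁻ t in Ioo 0 x, ∑' p : ι × ℕ, a p.1 * ENNReal.ofReal (t ^ (N p.1 + p.2)) := by
        refine setLIntegral_congr_fun measurableSet_Ioo fun t ht => ?_
        have ht0 : 0 ≤ t := ht.1.le
        rw [ofReal_one_div_one_sub ht0 (ht.2.trans_le hx1), ← ENNReal.tsum_mul_left,
          ENNReal.tsum_prod']
        refine tsum_congr fun i => ?_
        rw [← ENNReal.tsum_mul_right]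
        refine tsum_congr fun m => ?_
        rw [mul_comm, mul_assoc, ← ENNReal.ofReal_mul (pow_nonneg ht0 _), ← pow_add]
    _ = ∑' p : ι × ℕ, ∫⁻ t in Ioo 0 x, a p.1 * ENNReal.ofReal (t ^ (N p.1 + p.2)) :=
        lintegral_tsum fun p => ((measurable_ofReal_pow _).const_mul _).aemeasurable
    _ = ∑' p : ι × ℕ, a p.1 * ENNReal.ofReal (x ^ (N p.1 + p.2 + 1) / (N p.1 + p.2 + 1 : ℕ)) := by
        refine tsum_congr fun p => ?_
        rw [lintegral_const_mul _ (measurable_ofReal_pow _), lintegral_pow_Ioo _ hx0]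
        push_cast
        ring_nf

end MZVSimplex

end KZ

end Literature.NumberTheory.Transcendental
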